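import Mathlib.Analysis.Analytic.Basic
import Mathlib.Analysis.Analytic.Constructions
import Mathlib.Analysis.Calculus.Deriv.Basic
import Mathlib.Analysis.SpecialFunctions.Pow.Real
import Literature.Probability.LatticeModels.ConformalBootstrap
import HarnessLib

/-!
# Dolan–Osborn conformal blocks in three dimensions

The predicate `ConformalBlocks.IsDolanOsborn B` on a family `B : ConformalBlocks 3` of candidate
conformal blocks of four identical external scalars
(`Literature.Probability.LatticeModels.ConformalBlocks`, file `ConformalBootstrap.lean`):
`B.g Δ ℓ` **is the genuine `d = 3` conformal block** `g_{Δ,ℓ}(u,v)` for every `(Δ, ℓ)` in the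
unitary parameter domain `blockDomain ℓ`, characterised as printed by

1. the *Casimir equation*: in Dolan–Osborn variables `u = x z`, `v = (1 - x)(1 - z)` the pulled-back
   block `G(x,z) = g_{Δ,ℓ}(xz,(1-x)(1-z))` (`ConformalBlocks.doCoord`) is an eigenfunction of the
   second-order operator (`casimirOp`)
   `𝒟 = x²(1-x)∂ₓ² - x²∂ₓ + z²(1-z)∂_z² - z²∂_z + (xz/(x-z))((1-x)∂ₓ - (1-z)∂_z)`
   with eigenvalue `½ C_{Δ,ℓ}`, `C_{Δ,ℓ} = Δ(Δ-3) + ℓ(ℓ+1)` (`casimirEigenvalue`; Dolan–Osborn,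
   Nucl. Phys. B 678 (2004) 491 = hep-th/0309180, eq. (1.5) for `C_{Δ,ℓ}` and eqs. (2.2)–(2.4):
   `2 D_ε G = C_{Δ,ℓ} G` with `𝒟 = D_ε` at `a = -½Δ₁₂ = 0`, `b = ½Δ₃₄ = 0`, `c = 0`, `ε = d - 2 = 1`;
   Hogervorst–Rychkov, Phys. Rev. D 87 (2013) 106004 = arXiv:1303.1111, §2.2, eqs. (2.19), (2.21)
   of the arXiv version: `𝒟_{HR} G = C_{Δ,ℓ} G` with `½𝒟_{HR} = 𝒟` at `2ν = d - 2 = 1`;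
   Poland–Rychkov–Vichi, Rev. Mod. Phys. 91 (2019) 015002 = arXiv:1805.04405, §3.6.1 of the arXiv
   version, "The Casimir equation", operator `2𝒟`, eigenvalue `C_{Δ,ℓ}`), imposed on the real
   region `x, z ∈ (0,1)`, `x ≠ z`;
2. the *OPE boundary condition* singling the block out among the eigenfunctions (in particular
   from the shadow block, `C_{3-Δ,ℓ} = C_{Δ,ℓ}`, see `casimirEigenvalue_shadow`):
   `G(x,z) = (xz)^{(Δ-ℓ)/2} Φ(x,z)` near the corner `(0,0)` with `Φ` real-analytic at `(0,0)` and
   `Φ(x,0) = (-1/2)^ℓ x^ℓ (1 + O(x))`, i.e. `G ~ (-1/2)^ℓ x^{(Δ+ℓ)/2} z^{(Δ-ℓ)/2}` for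
   `0 < z ≪ x ≪ 1` (`HasDOBoundaryBehaviour`; Dolan–Osborn 2004, eq. (1.9):
   `G ~ u^{½(Δ-ℓ)} (-½(1-v))^ℓ ₂F₁(…; 1-v)` as `u → 0`, and eqs. (2.5), (2.7):
   `F_{λ₁λ₂} ~ x^{λ₁} z^{λ₂}` as `z → 0` then `x → 0`, `λ₁ = ½(Δ+ℓ)`, `λ₂ = ½(Δ-ℓ)`, with the
   expansion in two-variable Jack polynomials of §3 supplying `Φ`; Hogervorst–Rychkov 2013, §2.1,
   eq. (2.16) of the arXiv version: `g = Σₙ r^{Δ+n} Σⱼ A_{n,j} Ĉⱼ(cos θ)`, `A_{0,j} = δ_{jℓ}`,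
   `r = √(xz)`, `cos θ = (x+z)/(2√(xz))`; Poland–Rychkov–Vichi 2019, arXiv §3.6.1,
   `g ~ 𝒩_{d,ℓ} (z z̄)^{Δ/2} C_ℓ^{(d/2-1)}((z+z̄)/(2√(z z̄)))`,
   `𝒩_{d,ℓ} = ℓ!/((-2)^ℓ (d/2-1)_ℓ)`; for `d = 3`, `C_ℓ^{(1/2)} = P_ℓ` (Legendre) has leading
   coefficient `(2ℓ)!/(2^ℓ (ℓ!)²) = 2^ℓ (1/2)_ℓ/ℓ!`, so the coefficient of `x^{λ₁} z^{λ₂}` is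
   `𝒩_{3,ℓ} · 2^ℓ(1/2)_ℓ/ℓ! · 2^{-ℓ} = (-1/2)^ℓ`, the Dolan–Osborn normalisation);
3. *regularity*: `g_{Δ,ℓ}` is real-analytic in `(u,v)` on the whole convergence square
   `crossRatioSquare = (0,1)²` (Hogervorst–Rychkov 2013, §2.1, eq. (2.18) and text: the blocks are
   real-analytic on `z ∈ X = ℂ ∖ (1,∞)` except at `z = 0`; the square is the image of real
   `x, z ∈ (0,1)` — the sub-region
   `√u + √v ≤ 1` — together with complex-conjugate `z̄ = z*`, `|z| < 1`, `|1-z| < 1`; as a symmetric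
   analytic function of `(x,z)` the block is analytic in the elementary symmetric functions
   `x + z = 1 + u - v`, `xz = u`), and continuous in `Δ` on `blockDomain ℓ` (the blocks are
   meromorphic in `Δ` with poles only at non-unitary `Δ`, Kos–Poland–Simmons-Duffin, JHEP 11 (2014)
   109 = arXiv:1406.4858, §4);
4. `B.IsStandard` (identity block `g_{0,0} ≡ 1` and continuity on the square for all parameters).

Why this pins the block down (informal, for the reviewer; not formalised). On the real region the
symmetric analytic eigenfunctions of `𝒟` of the form `(xz)^{λ₂} Φ`, `Φ` analytic at `0`, are
determined degree by degree in the Taylor expansion of `Φ`: the homogeneous part of `𝒟` is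
diagonal on the two-variable Jack polynomials `𝒫_{E,j}` (Hogervorst–Rychkov 2013, §2.2, arXiv eqs.
(2.22)–(2.26); Dolan–Osborn 2004, §3, eqs. (3.1)–(3.3)), and the recursion
`(C_{Δ+n,j} - C_{Δ,ℓ}) A_{n,j} = γ⁺ A_{n-1,j-1} + γ⁻ A_{n-1,j+1}`, `A_{0,j} = δ_{jℓ}`
(Hogervorst–Rychkov 2013, arXiv eqs. (2.27)–(2.28); Dolan–Osborn 2004, eq. (3.12)) is
non-degenerate exactly off the poles of the blocks.
For `d = 3` and identical external scalars the poles in the closed unitary region are: `Δ = 1/2` at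
`ℓ = 0` (the second family `Δ* = d/2 - k`, `k = 1`, non-zero residue `c₂(1)`; Hogervorst–Rychkov
2013, §3.3, text below arXiv eq. (3.18): "the region close to the free scalar limit `l = 0`,
`Δ → ν` is understood excluded … the scalar conformal block becomes singular in this limit",
`B_{2,0} ~ (Δ-ν)⁻¹`) — whence `blockDomain 0` is the OPEN half-line `Δ > 1/2` and NOTHING is
required of `B.g (1/2) 0` (no block exists there; a `Δ = 1/2` scalar is a free field and decouples
from the OPE of two identical scalars) — and the removable points `Δ = ℓ + 1`, `ℓ ≥ 1` (third
family, `k = 1`, residue `∝ (½(1-k))_k = 0` for `Δ₁₂ = Δ₃₄ = 0`, Kos–Poland–Simmons-Duffin 2014,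
§4), where `C_{ℓ+2,ℓ-1} = C_{ℓ+1,ℓ}` and the eigenfunction is ambiguous up to the block of the
conserved current's null divergence; there the standard block `g_{ℓ+1,ℓ} = lim_{Δ ↓ ℓ+1} g_{Δ,ℓ}`
(Hogervorst–Rychkov 2013, §2.3, arXiv eqs. (2.30)–(2.31): `A_{1,ℓ-1} = (Δ-ℓ-2ν)ℓ/(4(ℓ+ν)) → 0`,
only `j = ℓ + n` survives at leading twist) is selected by the continuity-in-`Δ` clause. Off
these points uniqueness near the corner propagates to the whole square by the identity theorem for
real-analytic functions (clause 3), including the complex region `z̄ = z*`, where the Casimir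
equation then holds automatically.

Existence of a family satisfying `IsDolanOsborn` is the existence and regularity theory of the
`d = 3` blocks (Dolan–Osborn 2004, §3, eqs. (3.12)–(3.19); Hogervorst–Rychkov 2013, §2) and is NOT
formalised here (Mathlib has no hypergeometric/Jack-polynomial machinery for it): exactly as for
`ConformalBlocks.IsStandard`, statements consume `B.IsDolanOsborn` as the hypothesis "`B` is the
genuine family of three-dimensional blocks". What the predicate buys over `IsStandard` is that the
blocks can no longer be tailored to the data (cf. the mean-field counterexample
`Literature.MathematicalPhysics.QuantumFieldTheory.not_bootstrapIsland_of_isMeanFieldFamily`, whose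
blocks `u + u/v` violate `HasDOBoundaryBehaviour` at `(Δ,ℓ) = (1,0)`).

Design choices.
* `d = 3` only (the request; the parameter domain, the normalisation `(d/2-1)_ℓ` and the pole
  analysis are dimension-specific, and `d = 2` needs a separate limit).
* The Casimir operator is written with iterated one-variable `deriv`s (no mixed derivatives occur
  in the `x, z` variables); clause 3 makes `doCoord` real-analytic on `(0,1)²`
  (`IsDolanOsborn.analyticOnNhd_doCoord`), so these are classical derivatives, never junk values.
  The equation is imposed off the diagonal `x = z`, where the printed operator has the removable
  `1/(x-z)`; values on the diagonal (`√u + √v = 1`, containing the crossing-symmetric point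
  `u = v = 1/4`) are fixed by continuity.
* `blockDomain ℓ` is the unitary range of `IsUnitaryCFTData` (`Δ ≥ 1/2` for scalars, `Δ ≥ ℓ + 1`
  for `ℓ ≥ 1`, Poland–Rychkov–Vichi 2019, §II.C eq. (19)) minus the pole `(1/2, 0)`
  (`mem_blockDomain_of_unitarityBounds`); odd spins are included (the blocks exist; Bose symmetry of
  the OPE is a property of the data, not of the blocks). Nothing is required below the unitarity
  bounds, where further poles sit.
* Normalisation `(-1/2)^ℓ` = Dolan–Osborn 2004 = Poland–Rychkov–Vichi 2019 (the source of
  `ConformalBootstrap.lean`); Hogervorst–Rychkov's `A_{0,ℓ} = 1` blocks are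
  `(-2)^ℓ (1/2)_ℓ/ℓ!` times these (their footnote to arXiv eq. (2.16)). For even `ℓ` both are
  positive.

What is NOT here: existence/uniqueness theorems for the blocks, the radial (`ρ`) coordinates of
Hogervorst–Rychkov §3, positivity `A_{n,j} ≥ 0`, mixed-correlator blocks `g^{Δ₁₂,Δ₃₄}`.
-/

noncomputable section

namespace Literature.Probability.LatticeModels

open _root_.Filter _root_.Set
open scoped _root_.Topology

namespace ConformalBlocks

/-! ### The quadratic Casimir: eigenvalue and differential operator (`d = 3`) -/

/-- The quadratic conformal Casimir eigenvalue of a primary of dimension `Δ` and spin `ℓ` in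
`d = 3` dimensions, `C_{Δ,ℓ} = Δ(Δ - d) + ℓ(ℓ + d - 2) = Δ(Δ - 3) + ℓ(ℓ + 1)`.
(Dolan–Osborn, Nucl. Phys. B 678 (2004) 491, eq. (1.5); Hogervorst–Rychkov, Phys. Rev. D 87 (2013)
106004, arXiv eq. (2.19); Poland–Rychkov–Vichi 2019, arXiv §3.6.1.) [cite: DolanOsborn2004, eq. (1.5)] -/
def casimirEigenvalue (Δ : ℝ) (ℓ : ℕ) : ℝ :=
  Δ * (Δ - 3) + (ℓ : ℝ) * ((ℓ : ℝ) + 1)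

/-- Unfolding `casimirEigenvalue`. (Dolan–Osborn 2004, eq. (1.5).) [cite: DolanOsborn2004, eq. (1.5)] -/
theorem casimirEigenvalue_def (Δ : ℝ) (ℓ : ℕ) :
    casimirEigenvalue Δ ℓ = Δ * (Δ - 3) + (ℓ : ℝ) * ((ℓ : ℝ) + 1) :=
  rfl

/-- The identity (`Δ = 0`, `ℓ = 0`) has Casimir eigenvalue `0`. (Dolan–Osborn 2004, eq. (1.5).) [cite: DolanOsborn2004, eq. (1.5)] -/
@[simp] theorem casimirEigenvalue_zero_zero : casimirEigenvalue 0 0 = 0 := by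
  simp [casimirEigenvalue]

/-- The Casimir eigenvalue is invariant under the shadow transform `Δ ↦ d - Δ = 3 - Δ`; this is
why the eigenvalue equation alone does not determine the block and a boundary condition at
`x, z → 0` is part of the definition. (Dolan–Osborn 2004, eq. (1.5); Poland–Rychkov–Vichi 2019,
arXiv §3.6.6, shadow formalism.) [cite: DolanOsborn2004, eq. (1.5)] -/
theorem casimirEigenvalue_shadow (Δ : ℝ) (ℓ : ℕ) :
    casimirEigenvalue (3 - Δ) ℓ = casimirEigenvalue Δ ℓ := by
  simp only [casimirEigenvalue]
  ring

/-- The stress tensor (`Δ = 3`, `ℓ = 2`) has Casimir eigenvalue `6`. (Dolan–Osborn 2004, eq. (1.5).) [cite: DolanOsborn2004, eq. (1.5)] -/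
theorem casimirEigenvalue_three_two : casimirEigenvalue 3 2 = 6 := by
  simp [casimirEigenvalue]
  norm_num

/-- The Dolan–Osborn / Hogervorst–Rychkov quadratic-Casimir differential operator for four
identical external scalars in `d = 3`, in the variables `x, z` (`u = xz`, `v = (1-x)(1-z)`), applied
to a function `G(x,z)` at the point `(x,z)`:
`𝒟G = x²(1-x) G_xx - x² G_x + z²(1-z) G_zz - z² G_z + (xz/(x-z)) ((1-x) G_x - (1-z) G_z)`.
This is `D_ε` of Dolan–Osborn 2004, eqs. (2.3)–(2.4), at `a = -½Δ₁₂ = 0`, `b = ½Δ₃₄ = 0`, `c = 0`,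
`ε = d - 2 = 1`; it is `½𝒟` of Hogervorst–Rychkov 2013, arXiv eq. (2.21), at `2ν = d - 2 = 1`, and
one half of the operator of Poland–Rychkov–Vichi 2019, arXiv §3.6.1; the blocks satisfy
`𝒟 G = ½ C_{Δ,ℓ} G` (Dolan–Osborn 2004, eq. (2.2): `2 D_ε G = C_{Δ,ℓ} G`). Partial derivatives are
iterated one-variable `deriv`s (no mixed derivative occurs); meaningful off the diagonal `x ≠ z`
for `G` twice differentiable. (Dolan–Osborn, Nucl. Phys. B 678 (2004) 491, eqs. (2.2)–(2.4);
Hogervorst–Rychkov, Phys. Rev. D 87 (2013) 106004, arXiv eqs. (2.19), (2.21).) [cite: DolanOsborn2004, eqs. (2.2)–(2.4)] -/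
def casimirOp (G : ℝ → ℝ → ℝ) (x z : ℝ) : ℝ :=
  x ^ 2 * (1 - x) * deriv (fun s => deriv (fun t => G t z) s) x
      - x ^ 2 * deriv (fun t => G t z) x
    + (z ^ 2 * (1 - z) * deriv (fun s => deriv (fun t => G x t) s) z
      - z ^ 2 * deriv (fun t => G x t) z)
    + x * z / (x - z) * ((1 - x) * deriv (fun t => G t z) x - (1 - z) * deriv (fun t => G x t) z)

/-- Constants are annihilated by the Casimir operator (every term carries a derivative); in
particular the identity block `g_{0,0} ≡ 1` solves the Casimir equation with eigenvalue
`C_{0,0} = 0`. (Dolan–Osborn 2004, eq. (2.3).) [cite: DolanOsborn2004, eq. (2.3)] -/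
@[simp] theorem casimirOp_const (c x z : ℝ) : casimirOp (fun _ _ => c) x z = 0 := by
  simp [casimirOp]

/-! ### The unitary parameter domain -/

/-- The parameter domain on which `IsDolanOsborn` characterises the blocks `g_{Δ,ℓ}` of four
identical scalars in `d = 3`: the closed unitary region of Poland–Rychkov–Vichi 2019, §II.C,
eq. (19) (`Δ ≥ (d-2)/2 = 1/2` for `ℓ = 0`, `Δ ≥ ℓ + d - 2 = ℓ + 1` for `ℓ ≥ 1`) with the single
point `(Δ,ℓ) = (1/2, 0)` removed, where the `d = 3` block has a pole (second family of poles
`Δ* = d/2 - k`, `k = 1`, with non-vanishing residue for identical external scalars;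
Kos–Poland–Simmons-Duffin, JHEP 11 (2014) 109, §4, Table 1 and the coefficients `c₂(k)`;
Hogervorst–Rychkov 2013, §3.3, below arXiv eq. (3.18): the free-scalar limit `ℓ = 0`, `Δ → ν = 1/2`
is excluded, the scalar block being singular there). So `blockDomain 0 = (1/2, ∞)` and
`blockDomain (ℓ+1) = [ℓ+2, ∞)`. [cite: KosPolandSimmonsduffin2014, §4] -/
def blockDomain : ℕ → Set ℝ
  | 0 => Ioi (1 / 2)
  | ℓ + 1 => Ici ((ℓ : ℝ) + 2)

/-- Scalars: `Δ ∈ blockDomain 0 ↔ 1/2 < Δ`. (Kos–Poland–Simmons-Duffin 2014, §4.) [cite: KosPolandSimmonsduffin2014, §4] -/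
@[simp] theorem mem_blockDomain_zero {Δ : ℝ} : Δ ∈ blockDomain 0 ↔ 1 / 2 < Δ :=
  Iff.rfl

/-- Spin `ℓ + 1 ≥ 1`: `Δ ∈ blockDomain (ℓ+1) ↔ ℓ + 2 ≤ Δ` (unitarity bound `Δ ≥ spin + 1`).
(Poland–Rychkov–Vichi 2019, §II.C, eq. (19).) [cite: PolandRychkovVichi2019, §II.C eq. (19)] -/
@[simp] theorem mem_blockDomain_succ {Δ : ℝ} {ℓ : ℕ} :
    Δ ∈ blockDomain (ℓ + 1) ↔ (ℓ : ℝ) + 2 ≤ Δ :=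
  Iff.rfl

/-- Uniform description of the parameter domain: `ℓ = 0 ∧ Δ > 1/2`, or `ℓ ≥ 1 ∧ Δ ≥ ℓ + 1`.
(Poland–Rychkov–Vichi 2019, §II.C, eq. (19); Kos–Poland–Simmons-Duffin 2014, §4.) [cite: PolandRychkovVichi2019, §II.C eq. (19)] -/
theorem mem_blockDomain_iff {Δ : ℝ} {ℓ : ℕ} :
    Δ ∈ blockDomain ℓ ↔ (ℓ = 0 ∧ 1 / 2 < Δ) ∨ (1 ≤ ℓ ∧ (ℓ : ℝ) + 1 ≤ Δ) := by
  cases ℓ with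
  | zero => simp
  | succ ℓ =>
    simp only [mem_blockDomain_succ, Nat.succ_ne_zero, false_and, false_or, Nat.cast_succ,
      le_add_iff_nonneg_left, zero_le, true_and]
    constructor
    · intro h
      linarith
    · intro h
      linarith

/-- Conserved currents and the stress tensor lie in the domain: `Δ = spin + 1` for spin
`ℓ + 1 ≥ 1`, e.g. `(Δ,ℓ) = (3,2)`. (Poland–Rychkov–Vichi 2019, §II.C, eq. (19), saturated.) [cite: PolandRychkovVichi2019, §II.C eq. (19)] -/
theorem conserved_mem_blockDomain (ℓ : ℕ) : (ℓ : ℝ) + 2 ∈ blockDomain (ℓ + 1) := by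
  simp

/-- For CFT data satisfying the `d = 3` unitarity bounds, every non-identity primary lies in the
parameter domain of its spin, provided it is not a scalar of dimension exactly `1/2` (a free field,
where the block of identical scalars has a pole). (Poland–Rychkov–Vichi 2019, §II.C, eq. (19);
Kos–Poland–Simmons-Duffin 2014, §4.) [cite: PolandRychkovVichi2019, §II.C eq. (19)] -/
theorem mem_blockDomain_of_unitarityBounds {D : CFTData 3} (hD : D.SatisfiesUnitarityBounds)
    {i : D.ι} (hi : i ≠ D.unit) (hhalf : D.spin i = 0 → D.Δ i ≠ 1 / 2) :
    D.Δ i ∈ blockDomain (D.spin i) := by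
  obtain ⟨h0, h1⟩ := hD i hi
  rcases hs : D.spin i with _ | ℓ
  · have hle : (1 : ℝ) / 2 ≤ D.Δ i := by
      have := h0 hs
      norm_num at this ⊢
      linarith
    have hne : D.Δ i ≠ 1 / 2 := hhalf hs
    rw [mem_blockDomain_zero]
    exact lt_of_le_of_ne hle (Ne.symm hne)
  · have := h1 (by rw [hs]; exact Nat.succ_pos ℓ)
    rw [hs] at this
    rw [mem_blockDomain_succ]
    push_cast at this
    linarith

/-! ### Blocks in Dolan–Osborn variables and the boundary condition -/

/-- The block `g_{Δ,ℓ}` pulled back to the Dolan–Osborn variables: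
`B.doCoord Δ ℓ x z = g_{Δ,ℓ}(u,v)` at `u = x z`, `v = (1 - x)(1 - z)` (`x, z` play the role of
`z, z̄`; real and independent on the region `x, z ∈ (0,1)`). (Dolan–Osborn 2004, eq. (2.1);
Hogervorst–Rychkov 2013, arXiv eq. (2.5).) [cite: DolanOsborn2004, eq. (2.1)] -/
def doCoord (B : ConformalBlocks 3) (Δ : ℝ) (ℓ : ℕ) (x z : ℝ) : ℝ :=
  B.g Δ ℓ (x * z) ((1 - x) * (1 - z))

/-- Unfolding `doCoord`. (Dolan–Osborn 2004, eq. (2.1).) [cite: DolanOsborn2004, eq. (2.1)] -/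
@[simp] theorem doCoord_apply (B : ConformalBlocks 3) (Δ : ℝ) (ℓ : ℕ) (x z : ℝ) :
    B.doCoord Δ ℓ x z = B.g Δ ℓ (x * z) ((1 - x) * (1 - z)) :=
  rfl

/-- Real `x, z ∈ (0,1)` give cross-ratios `(xz, (1-x)(1-z))` in the convergence square.
(Hogervorst–Rychkov 2013, §2.1; Poland–Rychkov–Vichi 2019, §III.C.) [cite: PolandRychkovVichi2019, §III.C] -/
theorem doVars_mem_crossRatioSquare {x z : ℝ} (hx : x ∈ Ioo (0 : ℝ) 1) (hz : z ∈ Ioo (0 : ℝ) 1) :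
    (x * z, (1 - x) * (1 - z)) ∈ crossRatioSquare := by
  rw [mem_crossRatioSquare]
  obtain ⟨hx0, hx1⟩ := hx
  obtain ⟨hz0, hz1⟩ := hz
  refine ⟨⟨mul_pos hx0 hz0, ?_⟩, mul_pos (by linarith) (by linarith), ?_⟩
  · calc x * z < x * 1 := by gcongr
      _ < 1 := by linarith
  · calc (1 - x) * (1 - z) < (1 - x) * 1 := mul_lt_mul_of_pos_left (by linarith) (by linarith)
      _ < 1 := by linarith

/-- The Dolan–Osborn *OPE boundary condition* with the Dolan–Osborn normalisation for a function
`G` on the real region: near the corner `(0,0)`, `G(x,z) = (xz)^{(Δ-ℓ)/2} Φ(x,z)` with `Φ`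
real-analytic at `(0,0)` and `Φ(x,0)/x^ℓ → (-1/2)^ℓ` as `x → 0⁺`; i.e.
`G ~ (-1/2)^ℓ x^{(Δ+ℓ)/2} z^{(Δ-ℓ)/2}` as `z → 0` first and then `x → 0` (Dolan–Osborn 2004,
eq. (1.9): `G ~ u^{½(Δ-ℓ)} (-½(1-v))^ℓ ₂F₁(½(Δ+ℓ), ½(Δ+ℓ); Δ+ℓ; 1-v)` as `u → 0`, and eqs. (2.5),
(2.7): `F_{λ₁λ₂} ~ x^{λ₁} z^{λ₂}` as `z → 0` then `x → 0`, `λ₁ = ½(Δ+ℓ)`, `λ₂ = ½(Δ-ℓ)`, the series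
in Jack polynomials of §3, eqs. (3.12)–(3.19), supplying `Φ`), equivalently the leading term of
Hogervorst–Rychkov 2013, arXiv eq. (2.16) / Poland–Rychkov–Vichi 2019, arXiv §3.6.1:
`g ~ 𝒩_{3,ℓ} (xz)^{Δ/2} P_ℓ((x+z)/(2√(xz)))`, `𝒩_{3,ℓ} = ℓ!/((-2)^ℓ (1/2)_ℓ)`, since
`(xz)^{ℓ/2} P_ℓ((x+z)/(2√(xz)))` is a homogeneous polynomial of degree `ℓ` with `x^ℓ`-coefficient
`2^ℓ(1/2)_ℓ/ℓ! · 2^{-ℓ}`. [cite: DolanOsborn2004, eqs. (1.9), (2.5), (2.7)] -/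
def HasDOBoundaryBehaviour (G : ℝ → ℝ → ℝ) (Δ : ℝ) (ℓ : ℕ) : Prop :=
  ∃ Φ : ℝ × ℝ → ℝ, AnalyticAt ℝ Φ (0, 0) ∧
    (∀ᶠ p in 𝓝 (0 : ℝ × ℝ), 0 < p.1 → 0 < p.2 →
      G p.1 p.2 = (p.1 * p.2) ^ ((Δ - ℓ) / 2) * Φ p) ∧
    Tendsto (fun x : ℝ => Φ (x, 0) / x ^ ℓ) (𝓝[>] 0) (𝓝 ((-1 / 2 : ℝ) ^ ℓ))

/-! ### The predicate -/

/-- **`B` is the family of genuine Dolan–Osborn conformal blocks of four identical scalars in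
`d = 3`.** `B` is standard (`IsStandard`: `g_{0,0} ≡ 1`, continuity on the convergence square), and
for every spin `ℓ` and every `Δ ∈ blockDomain ℓ` (scalars `Δ > 1/2`; `Δ ≥ ℓ + 1` for `ℓ ≥ 1`):
(a) `(u,v) ↦ g_{Δ,ℓ}(u,v)` is real-analytic on `crossRatioSquare`; (b) `Δ' ↦ g_{Δ',ℓ}(u,v)` is
continuous on `blockDomain ℓ` for each `(u,v)` in the square; (c) the Casimir equation
`𝒟 G = ½ C_{Δ,ℓ} G` holds for `G = B.doCoord Δ ℓ` at all real `x ≠ z` in `(0,1)`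
(`casimirOp`, `casimirEigenvalue`); (d) `G` has the Dolan–Osborn boundary behaviour
`G ~ (-1/2)^ℓ x^{(Δ+ℓ)/2} z^{(Δ-ℓ)/2}` (`HasDOBoundaryBehaviour`). These are the defining
properties of the blocks as printed (Dolan–Osborn, Nucl. Phys. B 678 (2004) 491, §§1–3, eqs.
(1.5), (1.9), (2.1)–(2.7); Hogervorst–Rychkov, Phys. Rev. D 87 (2013) 106004, §2, arXiv eqs. (2.16),
(2.18), (2.19), (2.21), (2.27)–(2.28); Poland–Rychkov–Vichi, Rev. Mod. Phys. 91 (2019) 015002,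
arXiv §3.6.1), and on
`blockDomain` they determine `g_{Δ,ℓ}` on the whole square (module docstring: Jack-polynomial
recursion non-degenerate off the poles, continuity in `Δ` at the conserved-current points
`Δ = ℓ + 1`, identity theorem). Nothing is required at the pole `(Δ,ℓ) = (1/2,0)` or below the
unitarity bounds. Existence of such a `B` (the theory of 3d blocks) is not formalised; statements
take `B.IsDolanOsborn` as the hypothesis "`B` is the genuine family". [cite: DolanOsborn2004, §2 eqs. (2.2)–(2.7)] -/
def IsDolanOsborn (B : ConformalBlocks 3) : Prop :=
  B.IsStandard ∧
    ∀ (ℓ : ℕ) (Δ : ℝ), Δ ∈ blockDomain ℓ →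
      AnalyticOnNhd ℝ (fun p : ℝ × ℝ => B.g Δ ℓ p.1 p.2) crossRatioSquare ∧
      (∀ p ∈ crossRatioSquare, ContinuousOn (fun Δ' : ℝ => B.g Δ' ℓ p.1 p.2) (blockDomain ℓ)) ∧
      (∀ x z : ℝ, x ∈ Ioo (0 : ℝ) 1 → z ∈ Ioo (0 : ℝ) 1 → x ≠ z →
        casimirOp (B.doCoord Δ ℓ) x z = casimirEigenvalue Δ ℓ / 2 * B.doCoord Δ ℓ x z) ∧
      HasDOBoundaryBehaviour (B.doCoord Δ ℓ) Δ ℓ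

namespace IsDolanOsborn

variable {B : ConformalBlocks 3}

/-- Dolan–Osborn blocks are standard (identity block `1`, continuity on the square): the
requested implication `IsDolanOsborn B → IsStandard B`. (Poland–Rychkov–Vichi 2019, §III.A.) [cite: PolandRychkovVichi2019, §III.A] -/
theorem isStandard (h : B.IsDolanOsborn) : B.IsStandard :=
  h.1

/-- The identity block of a Dolan–Osborn family is `1`. (Poland–Rychkov–Vichi 2019, §III.A.) [cite: PolandRychkovVichi2019, §III.A] -/
theorem g_zero_zero (h : B.IsDolanOsborn) (u v : ℝ) : B.g 0 0 u v = 1 :=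
  h.1.1 u v

/-- On the parameter domain the blocks are real-analytic on the convergence square.
(Hogervorst–Rychkov 2013, §2.1, arXiv eq. (2.18) and text.) [cite: HogervorstRychkov2013, §2.1] -/
theorem analyticOnNhd (h : B.IsDolanOsborn) {ℓ : ℕ} {Δ : ℝ} (hΔ : Δ ∈ blockDomain ℓ) :
    AnalyticOnNhd ℝ (fun p : ℝ × ℝ => B.g Δ ℓ p.1 p.2) crossRatioSquare :=
  (h.2 ℓ Δ hΔ).1

/-- On the parameter domain the blocks depend continuously on `Δ`.
(Kos–Poland–Simmons-Duffin 2014, §4: meromorphy in `Δ` with non-unitary poles.) [cite: KosPolandSimmonsduffin2014, §4] -/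
theorem continuousOn_delta (h : B.IsDolanOsborn) {ℓ : ℕ} {Δ : ℝ} (hΔ : Δ ∈ blockDomain ℓ)
    {p : ℝ × ℝ} (hp : p ∈ crossRatioSquare) :
    ContinuousOn (fun Δ' : ℝ => B.g Δ' ℓ p.1 p.2) (blockDomain ℓ) :=
  (h.2 ℓ Δ hΔ).2.1 p hp

/-- The Casimir equation `𝒟 G = ½ C_{Δ,ℓ} G` in Dolan–Osborn variables, off the diagonal.
(Dolan–Osborn 2004, eq. (2.2); Hogervorst–Rychkov 2013, arXiv eqs. (2.19), (2.21).) [cite: DolanOsborn2004, eq. (2.2)] -/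
theorem casimir_eq (h : B.IsDolanOsborn) {ℓ : ℕ} {Δ : ℝ} (hΔ : Δ ∈ blockDomain ℓ) {x z : ℝ}
    (hx : x ∈ Ioo (0 : ℝ) 1) (hz : z ∈ Ioo (0 : ℝ) 1) (hxz : x ≠ z) :
    casimirOp (B.doCoord Δ ℓ) x z = casimirEigenvalue Δ ℓ / 2 * B.doCoord Δ ℓ x z :=
  (h.2 ℓ Δ hΔ).2.2.1 x z hx hz hxz

/-- The Dolan–Osborn boundary behaviour `G ~ (-1/2)^ℓ x^{(Δ+ℓ)/2} z^{(Δ-ℓ)/2}` at the corner.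
(Dolan–Osborn 2004, eqs. (1.9), (2.5), (2.7).) [cite: DolanOsborn2004, eqs. (1.9), (2.5), (2.7)] -/
theorem boundary (h : B.IsDolanOsborn) {ℓ : ℕ} {Δ : ℝ} (hΔ : Δ ∈ blockDomain ℓ) :
    HasDOBoundaryBehaviour (B.doCoord Δ ℓ) Δ ℓ :=
  (h.2 ℓ Δ hΔ).2.2.2

/-- The pulled-back block `G(x,z) = g_{Δ,ℓ}(xz,(1-x)(1-z))` of a Dolan–Osborn family is
real-analytic on the real region `(0,1)²` (composition of clause (a) with a polynomial map), so the
derivatives in `casimirOp` are classical. (Hogervorst–Rychkov 2013, §2.1.) [cite: HogervorstRychkov2013, §2.1] -/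
theorem analyticOnNhd_doCoord (h : B.IsDolanOsborn) {ℓ : ℕ} {Δ : ℝ} (hΔ : Δ ∈ blockDomain ℓ) :
    AnalyticOnNhd ℝ (fun p : ℝ × ℝ => B.doCoord Δ ℓ p.1 p.2) (Ioo (0 : ℝ) 1 ×ˢ Ioo (0 : ℝ) 1) := by
  intro p hp
  have hmem : (p.1 * p.2, (1 - p.1) * (1 - p.2)) ∈ crossRatioSquare :=
    doVars_mem_crossRatioSquare hp.1 hp.2
  have hg : AnalyticAt ℝ (fun q : ℝ × ℝ => B.g Δ ℓ q.1 q.2) (p.1 * p.2, (1 - p.1) * (1 - p.2)) :=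
    h.analyticOnNhd hΔ _ hmem
  exact hg.comp₂ (analyticAt_fst.mul analyticAt_snd)
    ((analyticAt_const.sub analyticAt_fst).mul (analyticAt_const.sub analyticAt_snd))

end IsDolanOsborn

/-- For a standard family the identity block `G ≡ 1` satisfies the Casimir equation with
eigenvalue `C_{0,0} = 0` identically — the `(Δ,ℓ) = (0,0)` instance of clause (c), consistent with
`IsStandard` (which is all `IsDolanOsborn` asks at `(0,0) ∉ blockDomain 0`).
(Dolan–Osborn 2004, eqs. (1.5), (2.2).) [cite: DolanOsborn2004, eq. (2.2)] -/
theorem IsStandard.casimir_eq_unit {B : ConformalBlocks 3} (h : B.IsStandard) (x z : ℝ) :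
    casimirOp (B.doCoord 0 0) x z = casimirEigenvalue 0 0 / 2 * B.doCoord 0 0 x z := by
  have h1 : B.doCoord 0 0 = fun _ _ => (1 : ℝ) := by
    funext s t
    exact h.g_zero_zero _ _
  rw [h1, casimirOp_const, casimirEigenvalue_zero_zero]
  simp

end ConformalBlocks

end Literature.Probability.LatticeModels

end
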